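import Literature.AlgebraicGeometry.Resolution.CobordantBlowupExtReesBridge
import Literature.AlgebraicGeometry.Resolution.CobordantBlowupFiltrationLocalization
import Mathlib.RingTheory.Localization.AtPrime.Basic
import HarnessLib

/-!
# Cobordant blow-ups (Włodarczyk 2022): local rings of `Spec ⊕ 𝒥ₙ tⁿ` over a point are local rings of the GAME-SIDE
# carrier `extReesAlgebra` of the localised filtration (CHART → STALK → GAME SIDE at a prime)

Topic: `Literature/AlgebraicGeometry/Resolution`. Sequel of `CobordantBlowupExtReesBridge.lean` (the three-algebra bridge
`extReesAlgebra 𝒥 = ⊕ 𝒥ₙ tⁿ = A[t⁻¹, uᵢ t^{wᵢ}]`) and `CobordantBlowupFiltrationLocalization.lean` (extended Rees algebras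
localise at any submonoid; Włodarczyk, arXiv:2203.03090, App. Def. 5.1.1: "`B := Spec_X(R[t⁻¹])`" is the relative spectrum of
a quasi-coherent algebra, so its local rings over `y` only see the STALK filtration `𝒥ₙ,y`).

* §4 `exists_ringEquiv_localizationAtPrime(_map)` — a ring isomorphism `e : R ≅ P` matching primes `𝔫 ↔ 𝔫'` induces
  `R_𝔫 ≃+* P_𝔫'` compatible with the structure maps (`IsLocalization.ringEquivOfRingEquiv`);
* §5 over `A' = M⁻¹A` with `𝒥ₙ' = 𝒥ₙ A'` and a prime `𝔫` of `⊕ 𝒥ₙ tⁿ` missing `M`: the extended prime `𝔫 ⊕𝒥ₙ'tⁿ` is prime and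
  contracts to `𝔫` (`isPrime_map_extendedReesMap`, `comap_map_extendedReesMap`), the irrelevant ideal extends to the
  irrelevant ideal (`irrelevant_eq_map_extendedReesMap`), `(⊕ 𝒥ₙ tⁿ)_𝔫 ≅ (⊕ 𝒥ₙ' tⁿ)_{𝔫⊕𝒥ₙ'tⁿ}`
  (`exists_ringEquiv_localization_map_extendedReesMap`) and, through the identification `e : extReesAlgebra I' ≅ ⊕ 𝒥ₙ' tⁿ` of
  the bridge file, **`(⊕ 𝒥ₙ tⁿ)_𝔫 ≅ (extReesAlgebra I')_{𝔫'}`** with `𝔫' = e⁻¹(𝔫 ⊕𝒥ₙ'tⁿ)`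
  (`exists_ringEquiv_localization_extReesAlgebra`), together with the DICTIONARY at the prime: structure maps from the base
  (`ringEquiv_localization_algebraMap_base`), `t⁻¹ ∈ 𝔫' ↔ t⁻¹ ∈ 𝔫` (`tInv_mem_iff_T_mem`), vertex ideal `≤ 𝔫'` iff irrelevant
  ideal `≤ 𝔫` (`vertexIdeal_le_iff_irrelevant_le`), and `𝔫'` over `𝔭A'` iff `𝔫` over `𝔭` (`map_algebraMap_le_iff_map_algebraMap_le`).

Use (door crux `HypersurfaceCentreConstruction` of route `WeightedInvariant`, assembly step [S6]): with `A = Γ(Y, U)`, `𝒥ₙ` the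
pieces of a Rees filtration over the affine chart `U` (`ReesFiltration.sectionsRing`), `M = A ∖ 𝔭_y`, `A' = 𝒪_{Y,y}` and
`Iₙ' = stalkIdeal 𝒥ₙ y`, the local rings of the global cobordant blow-up `Spec_Y ⊕ 𝒥ₙ tⁿ` at the points over `y` are the
successors `Localization.AtPrime 𝔫'` of the local weighted game played on `extReesAlgebra (weightedMonomialIdeal u w)`,
`weightedMonomialIdeal u w = I'`. All proofs are glue on Mathlib and the tree; no definition is declared.

## Sources

* J. Włodarczyk, *Functorial resolution by torus actions*, arXiv:2203.03090: Def. 2.3.5, App. Def. 5.1.1. [Wlodarczyk2022]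
-/

noncomputable section

open scoped LaurentPolynomial
open LaurentPolynomial

namespace Literature.AlgebraicGeometry.Resolution

universe u v

/-! ## §4 Local rings at corresponding primes -/

section Localization

variable {R : Type u} {P : Type v} [CommRing R] [CommRing P] (e : R ≃+* P)

/-- Along a ring isomorphism matching the primes `𝔫 ↔ 𝔫'`: `y ∉ 𝔫'` iff `e⁻¹ y ∉ 𝔫`. [folklore] -/
private theorem mem_primeCompl_iff_symm_mem (𝔫 : Ideal R) [𝔫.IsPrime] (𝔫' : Ideal P) [𝔫'.IsPrime] (h : 𝔫'.comap e = 𝔫)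
    (y : P) : y ∈ 𝔫'.primeCompl ↔ e.symm y ∈ 𝔫.primeCompl := by
  subst h
  show y ∉ 𝔫' ↔ e.symm y ∉ Ideal.comap e 𝔫'
  rw [Ideal.mem_comap, e.apply_symm_apply]

/-- The complement of a prime is carried onto the complement of the corresponding prime. [folklore] -/
private theorem primeCompl_map_eq_of_comap_eq (𝔫 : Ideal R) [𝔫.IsPrime] (𝔫' : Ideal P) [𝔫'.IsPrime] (h : 𝔫'.comap e = 𝔫) :
    𝔫.primeCompl.map e.toMonoidHom = 𝔫'.primeCompl := by
  ext y
  rw [Submonoid.mem_map]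
  constructor
  · rintro ⟨x, hx, rfl⟩
    refine (mem_primeCompl_iff_symm_mem e 𝔫 𝔫' h _).mpr ?_
    simpa using hx
  · intro hy
    exact ⟨e.symm y, (mem_primeCompl_iff_symm_mem e 𝔫 𝔫' h y).mp hy, e.apply_symm_apply y⟩

/-- **A ring isomorphism matching two primes induces an isomorphism of the local rings** `R_𝔫 ≃+* P_𝔫'` compatible with the
structure maps (`IsLocalization.ringEquivOfRingEquiv`). [folklore] -/
private theorem exists_ringEquiv_localizationAtPrime (𝔫 : Ideal R) [𝔫.IsPrime] (𝔫' : Ideal P) [𝔫'.IsPrime]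
    (h : 𝔫'.comap e = 𝔫) :
    ∃ f : Localization.AtPrime 𝔫 ≃+* Localization.AtPrime 𝔫',
      ∀ x : R, f (algebraMap R (Localization.AtPrime 𝔫) x) = algebraMap P (Localization.AtPrime 𝔫') (e x) :=
  ⟨IsLocalization.ringEquivOfRingEquiv (Localization.AtPrime 𝔫) (Localization.AtPrime 𝔫') e
      (primeCompl_map_eq_of_comap_eq e 𝔫 𝔫' h),
    fun x => IsLocalization.ringEquivOfRingEquiv_eq _ x⟩

/-- The same for the prime `𝔫.map e` corresponding to a prime `𝔫` of the source. [folklore] -/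
private theorem exists_ringEquiv_localizationAtPrime_map (𝔫 : Ideal R) [𝔫.IsPrime] :
    ∃ f : Localization.AtPrime 𝔫 ≃+* Localization.AtPrime (𝔫.map e),
      ∀ x : R, f (algebraMap R (Localization.AtPrime 𝔫) x) =
        algebraMap P (Localization.AtPrime (𝔫.map e)) (e x) :=
  exists_ringEquiv_localizationAtPrime e 𝔫 (𝔫.map e)
    (Ideal.comap_map_of_bijective e e.bijective)

/-- **Local rings of the full cobordant blow-up agree in the two presentations `extReesAlgebra I` / `⊕ 𝒥ₙ tⁿ`**: along an
identification `e` (identity on Laurent polynomials, `IdealFiltration.exists_ringEquiv_extReesAlgebra`) and for a prime `𝔫` of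
`⊕ 𝒥ₙ tⁿ`, `(⊕ 𝒥ₙ tⁿ)_𝔫 ≃+* (extReesAlgebra I)_{e⁻¹ 𝔫}` compatibly with the structure maps (`e⁻¹ 𝔫 = 𝔫.map e.symm = 𝔫.comap e`).
[cite: Wlodarczyk2022, Def. 5.1.1] -/
theorem IdealFiltration.exists_ringEquiv_localization_symm {A : Type u} [CommRing A] (F : IdealFiltration A) {I : ℕ → Ideal A}
    (e : extReesAlgebra I ≃+* F.extendedRees) (𝔫 : Ideal F.extendedRees) [𝔫.IsPrime] :
    ∃ f : Localization.AtPrime 𝔫 ≃+* Localization.AtPrime (𝔫.map e.symm),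
      ∀ x : F.extendedRees, f (algebraMap F.extendedRees (Localization.AtPrime 𝔫) x) =
        algebraMap (extReesAlgebra I) (Localization.AtPrime (𝔫.map e.symm)) (e.symm x) :=
  exists_ringEquiv_localizationAtPrime_map e.symm 𝔫

/-- … and in the direction `extReesAlgebra I → ⊕ 𝒥ₙ tⁿ`: `(extReesAlgebra I)_𝔫 ≃+* (⊕ 𝒥ₙ tⁿ)_{e 𝔫}`. [cite: Wlodarczyk2022, Def. 5.1.1] -/
theorem IdealFiltration.exists_ringEquiv_localization {A : Type u} [CommRing A] (F : IdealFiltration A) {I : ℕ → Ideal A}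
    (e : extReesAlgebra I ≃+* F.extendedRees) (𝔫 : Ideal (extReesAlgebra I)) [𝔫.IsPrime] :
    ∃ f : Localization.AtPrime 𝔫 ≃+* Localization.AtPrime (𝔫.map e),
      ∀ x : extReesAlgebra I, f (algebraMap (extReesAlgebra I) (Localization.AtPrime 𝔫) x) =
        algebraMap F.extendedRees (Localization.AtPrime (𝔫.map e)) (e x) :=
  exists_ringEquiv_localizationAtPrime_map e 𝔫

/-- **Local rings of the full cobordant blow-up agree in the two presentations `extReesAlgebra (weightedMonomialIdeal u w)` /
`cobordantAlgebra u w = A[t⁻¹, uᵢ t^{wᵢ}]`**: `(extReesAlgebra …)_𝔫 ≃+* (cobordantAlgebra u w)_{e 𝔫}` compatibly with the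
structure maps, for an identification `e` as in `exists_ringEquiv_extReesAlgebra_cobordantAlgebra`. [cite: Wlodarczyk2022, Def. 2.3.5] -/
theorem exists_ringEquiv_localization_cobordantAlgebra {A : Type u} [CommRing A] {m : ℕ} (u : Fin m → A) (w : Fin m → ℕ)
    (e : extReesAlgebra (weightedMonomialIdeal u w) ≃+* cobordantAlgebra u w)
    (𝔫 : Ideal (extReesAlgebra (weightedMonomialIdeal u w))) [𝔫.IsPrime] :
    ∃ f : Localization.AtPrime 𝔫 ≃+* Localization.AtPrime (𝔫.map e),
      ∀ x, f (algebraMap _ (Localization.AtPrime 𝔫) x) =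
        algebraMap (cobordantAlgebra u w) (Localization.AtPrime (𝔫.map e)) (e x) :=
  exists_ringEquiv_localizationAtPrime_map e 𝔫

end Localization

/-! ## §5 CHART → STALK → GAME SIDE at a prime: local rings of `Spec ⊕ 𝒥ₙ tⁿ` over `M⁻¹A` are local rings of
`extReesAlgebra` of the localised filtration -/

section CoeffMaps

variable {A : Type u} [CommRing A] {A' : Type v} [CommRing A']

/-- Coefficientwise maps fix the monomials `tⁿ`. [folklore] -/
private theorem mapRingHom_T (φ : A →+* A') (n : ℤ) : AddMonoidAlgebra.mapRingHom ℤ φ (T n : A[T;T⁻¹]) = T n := by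
  change AddMonoidAlgebra.mapRingHom ℤ φ (AddMonoidAlgebra.single n (1 : A)) = AddMonoidAlgebra.single n (1 : A')
  rw [AddMonoidAlgebra.mapRingHom_single, map_one]

/-- Coefficientwise maps act on constants through the coefficient map. [folklore] -/
private theorem mapRingHom_C (φ : A →+* A') (a : A) : AddMonoidAlgebra.mapRingHom ℤ φ (C a) = C (φ a) := by
  rw [← single_eq_C, AddMonoidAlgebra.mapRingHom_single, single_eq_C]

end CoeffMaps

section StalkBridge

variable {A : Type u} [CommRing A] {A' : Type v} [CommRing A'] [Algebra A A']
  (F : IdealFiltration A) (F' : IdealFiltration A') (M : Submonoid A) [IsLocalization M A']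
  (heq : ∀ n, F'.ideal n = (F.ideal n).map (algebraMap A A'))

namespace IdealFiltration

/-- The coefficientwise localisation map `⊕ 𝒥ₙ tⁿ → ⊕ 𝒥ₙ' tⁿ` sends `t⁻¹` to `t⁻¹`. [cite: Wlodarczyk2022, Def. 5.1.1] -/
theorem extendedReesMap_T (hle : ∀ n, (F.ideal n).map (algebraMap A A') ≤ F'.ideal n) :
    F.extendedReesMap F' hle ⟨T (-1), F.T_neg_one_mem_extendedRees⟩ = ⟨T (-1), F'.T_neg_one_mem_extendedRees⟩ :=
  Subtype.ext (mapRingHom_T (algebraMap A A') (-1))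

/-- … and commutes with the structure maps: `a t⁰ ↦ (a/1) t⁰`. [cite: Wlodarczyk2022, Def. 5.1.1] -/
theorem extendedReesMap_algebraMap (hle : ∀ n, (F.ideal n).map (algebraMap A A') ≤ F'.ideal n) (a : A) :
    F.extendedReesMap F' hle (algebraMap A F.extendedRees a) = algebraMap A' F'.extendedRees (algebraMap A A' a) := by
  apply Subtype.ext
  rw [coe_extendedReesMap, Subalgebra.coe_algebraMap, Subalgebra.coe_algebraMap, ← C_eq_algebraMap, ← C_eq_algebraMap,
    mapRingHom_C]

/-- Structure maps from the base along a comparison of local rings: if `g : (⊕𝒥ₙtⁿ)_𝔫 ≅ (extReesAlgebra I')_{𝔫'}` satisfies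
`g ∘ (⊕𝒥ₙtⁿ → (⊕𝒥ₙtⁿ)_𝔫) = (extReesAlgebra I' → (extReesAlgebra I')_{𝔫'}) ∘ e⁻¹ ∘ (⊕𝒥ₙtⁿ → ⊕𝒥ₙ'tⁿ)` (as produced by
`exists_ringEquiv_localization_extReesAlgebra` below), then `A → (⊕𝒥ₙtⁿ)_𝔫 ≅ …` equals `A → A' → (extReesAlgebra I')_{𝔫'}`.
[cite: Wlodarczyk2022, Def. 5.1.1] -/
theorem ringEquiv_localization_algebraMap_base (hle : ∀ n, (F.ideal n).map (algebraMap A A') ≤ F'.ideal n)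
    {I' : ℕ → Ideal A'} (e : extReesAlgebra I' ≃+* F'.extendedRees) (he : ∀ x, ((e x : F'.extendedRees) : A'[T;T⁻¹]) = x)
    (𝔫 : Ideal F.extendedRees) [𝔫.IsPrime] (𝔫' : Ideal (extReesAlgebra I')) [𝔫'.IsPrime]
    (g : Localization.AtPrime 𝔫 ≃+* Localization.AtPrime 𝔫')
    (hg : ∀ x : F.extendedRees, g (algebraMap F.extendedRees (Localization.AtPrime 𝔫) x) =
      algebraMap (extReesAlgebra I') _ (e.symm (F.extendedReesMap F' hle x))) (a : A) :
    g (algebraMap F.extendedRees (Localization.AtPrime 𝔫) (algebraMap A F.extendedRees a)) =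
      algebraMap (extReesAlgebra I') _ (algebraMap A' (extReesAlgebra I') (algebraMap A A' a)) := by
  rw [hg, extendedReesMap_algebraMap, ← apply_algebraMap_eq e.symm (coe_symm_apply_eq e he) (algebraMap A A' a)]

include M heq

/-- Over `A' = M⁻¹A` with `𝒥ₙ' = 𝒥ₙ A'`: **the irrelevant ideal of `⊕ 𝒥ₙ' tⁿ` is the extension of that of `⊕ 𝒥ₙ tⁿ`** (the vertex
pulls back to the vertex). [cite: Wlodarczyk2022, Def. 5.1.1] -/
theorem irrelevant_eq_map_extendedReesMap :
    F'.irrelevant = F.irrelevant.map (F.extendedReesMap F' fun n => (heq n).ge) := by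
  have hle : ∀ n, (F.ideal n).map (algebraMap A A') ≤ F'.ideal n := fun n => (heq n).ge
  apply le_antisymm
  · rw [IdealFiltration.irrelevant, Ideal.span_le]
    rintro y ⟨n, a', hn, ha', hy⟩
    -- `a' = a / s` with `a ∈ 𝒥ₙ`, `s ∈ M`
    rw [heq n] at ha'
    obtain ⟨⟨⟨a, ha⟩, s⟩, has⟩ := (IsLocalization.mem_map_algebraMap_iff M A').mp ha'
    dsimp only at has
    -- the generator `a tⁿ` upstairs and the unit `s/1` downstairs
    have hx : (⟨C a * T (n : ℤ), F.C_mul_T_mem_extendedRees_iff.mpr ha⟩ : F.extendedRees) ∈ F.irrelevant :=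
      Ideal.subset_span ⟨n, a, hn, ha, rfl⟩
    -- `y * (s/1) = image of a tⁿ`
    have hys : y * algebraMap A' F'.extendedRees (algebraMap A A' s) =
        F.extendedReesMap F' hle ⟨C a * T (n : ℤ), F.C_mul_T_mem_extendedRees_iff.mpr ha⟩ := by
      apply Subtype.ext
      rw [MulMemClass.coe_mul, hy, Subalgebra.coe_algebraMap, ← C_eq_algebraMap, coe_extendedReesMap, map_mul,
        mapRingHom_C, mapRingHom_T, mul_right_comm, ← map_mul, has]
    have hu : IsUnit (algebraMap A' F'.extendedRees (algebraMap A A' s)) :=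
      (IsLocalization.map_units A' s).map _
    rw [SetLike.mem_coe, ← Ideal.unit_mul_mem_iff_mem _ hu, mul_comm, hys]
    exact Ideal.mem_map_of_mem _ hx
  · rw [IdealFiltration.irrelevant, Ideal.map_span, Ideal.span_le]
    rintro _ ⟨x, ⟨n, a, hn, ha, hx⟩, rfl⟩
    refine Ideal.subset_span ⟨n, algebraMap A A' a, hn, ?_, ?_⟩
    · rw [heq n]; exact Ideal.mem_map_of_mem _ ha
    · rw [coe_extendedReesMap, hx, map_mul, ← single_eq_C, AddMonoidAlgebra.mapRingHom_single, single_eq_C, T,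
        AddMonoidAlgebra.mapRingHom_single, map_one]
      rfl

variable (𝔫 : Ideal F.extendedRees) [𝔫.IsPrime]
  (hd : Disjoint ((M.map (algebraMap A F.extendedRees) : Submonoid F.extendedRees) : Set F.extendedRees) 𝔫)

include hd

/-- Over `A' = M⁻¹A` with `𝒥ₙ' = 𝒥ₙ A'`: a prime `𝔫` of `⊕ 𝒥ₙ tⁿ` missing `M` EXTENDS to a prime of `⊕ 𝒥ₙ' tⁿ` (primes of a
localisation). [cite: Wlodarczyk2022, Def. 5.1.1] -/
theorem isPrime_map_extendedReesMap : (𝔫.map (F.extendedReesMap F' fun n => (heq n).ge)).IsPrime := by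
  letI := (F.extendedReesMap F' fun n => (heq n).ge).toAlgebra
  haveI := F.isLocalization_extendedRees F' M heq
  exact IsLocalization.isPrime_of_isPrime_disjoint (M.map (algebraMap A F.extendedRees)) F'.extendedRees 𝔫 ‹_› hd

/-- … which contracts back to `𝔫`. [cite: Wlodarczyk2022, Def. 5.1.1] -/
theorem comap_map_extendedReesMap :
    (𝔫.map (F.extendedReesMap F' fun n => (heq n).ge)).comap (F.extendedReesMap F' fun n => (heq n).ge) = 𝔫 := by
  letI := (F.extendedReesMap F' fun n => (heq n).ge).toAlgebra
  haveI := F.isLocalization_extendedRees F' M heq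
  exact IsLocalization.under_map_of_isPrime_disjoint (M.map (algebraMap A F.extendedRees)) F'.extendedRees ‹_› hd

/-- Membership test along the extension: `x ∈ 𝔫 ↔ x ↦ 𝔫 ⊕𝒥ₙ'tⁿ`. [cite: Wlodarczyk2022, Def. 5.1.1] -/
theorem mem_iff_extendedReesMap_mem_map (x : F.extendedRees) :
    x ∈ 𝔫 ↔ F.extendedReesMap F' (fun n => (heq n).ge) x ∈ 𝔫.map (F.extendedReesMap F' fun n => (heq n).ge) := by
  conv_lhs => rw [← F.comap_map_extendedReesMap F' M heq 𝔫 hd]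
  rw [Ideal.mem_comap]

/-- In particular for `t⁻¹` (the exceptional fibres correspond). [cite: Wlodarczyk2022, Lemma 2.3.8] -/
theorem T_mem_iff_T_mem_map :
    (⟨T (-1), F.T_neg_one_mem_extendedRees⟩ : F.extendedRees) ∈ 𝔫 ↔
      (⟨T (-1), F'.T_neg_one_mem_extendedRees⟩ : F'.extendedRees) ∈ 𝔫.map (F.extendedReesMap F' fun n => (heq n).ge) := by
  rw [F.mem_iff_extendedReesMap_mem_map F' M heq 𝔫 hd, extendedReesMap_T]

/-- … and for the vertex (the vertex points correspond). [cite: Wlodarczyk2022, Def. 5.1.1] -/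
theorem irrelevant_le_iff_irrelevant_le_map :
    F.irrelevant ≤ 𝔫 ↔ F'.irrelevant ≤ 𝔫.map (F.extendedReesMap F' fun n => (heq n).ge) := by
  rw [F.irrelevant_eq_map_extendedReesMap F' M heq]
  constructor
  · exact fun h => Ideal.map_mono h
  · intro h
    rw [← F.comap_map_extendedReesMap F' M heq 𝔫 hd]
    exact (Ideal.map_le_iff_le_comap.mp h)

/-- The complements of `𝔫` and of the contraction of its extension agree (as submonoids; no instance transport needed
downstream). [folklore] -/
private theorem primeCompl_comap_map_extendedReesMap [(𝔫.map (F.extendedReesMap F' fun n => (heq n).ge)).IsPrime] :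
    ((𝔫.map (F.extendedReesMap F' fun n => (heq n).ge)).comap (F.extendedReesMap F' fun n => (heq n).ge)).primeCompl =
      𝔫.primeCompl := by
  ext x
  show x ∉ _ ↔ x ∉ _
  rw [F.comap_map_extendedReesMap F' M heq 𝔫 hd]

/-- **The local ring `(⊕ 𝒥ₙ tⁿ)_𝔫` is the local ring `(⊕ 𝒥ₙ' tⁿ)_{𝔫 ⊕𝒥ₙ'tⁿ}` at the extended prime** (localisation of a
localisation, `isLocalization_atPrime_extendedRees_localization`), by a ring isomorphism compatible with the structure maps.
The primality instance of the extended prime is `isPrime_map_extendedReesMap`. [cite: Wlodarczyk2022, Def. 5.1.1] -/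
theorem exists_ringEquiv_localization_map_extendedReesMap [(𝔫.map (F.extendedReesMap F' fun n => (heq n).ge)).IsPrime] :
    ∃ f : Localization.AtPrime 𝔫 ≃+* Localization.AtPrime (𝔫.map (F.extendedReesMap F' fun n => (heq n).ge)),
      ∀ x : F.extendedRees, f (algebraMap F.extendedRees (Localization.AtPrime 𝔫) x) =
        algebraMap F'.extendedRees (Localization.AtPrime (𝔫.map (F.extendedReesMap F' fun n => (heq n).ge)))
          (F.extendedReesMap F' (fun n => (heq n).ge) x) := by
  letI := (F.extendedReesMap F' fun n => (heq n).ge).toAlgebra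
  haveI := F.isLocalization_extendedRees F' M heq
  -- K3: the local ring upstairs is a localisation of `⊕ 𝒥ₙ tⁿ` at the contracted prime, which is `𝔫`
  have hK3 := F.isLocalization_atPrime_extendedRees_localization F' M heq
    (𝔫.map (F.extendedReesMap F' fun n => (heq n).ge))
  have hloc : IsLocalization 𝔫.primeCompl
      (Localization.AtPrime (𝔫.map (F.extendedReesMap F' fun n => (heq n).ge))) := by
    rw [← F.primeCompl_comap_map_extendedReesMap F' M heq 𝔫 hd]
    exact hK3
  refine ⟨(IsLocalization.algEquiv 𝔫.primeCompl (Localization.AtPrime 𝔫)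
      (Localization.AtPrime (𝔫.map (F.extendedReesMap F' fun n => (heq n).ge)))).toRingEquiv, fun x => ?_⟩
  change IsLocalization.algEquiv 𝔫.primeCompl (Localization.AtPrime 𝔫)
      (Localization.AtPrime (𝔫.map (F.extendedReesMap F' fun n => (heq n).ge))) (algebraMap _ _ x) = _
  rw [AlgEquiv.commutes, IsScalarTower.algebraMap_apply F.extendedRees F'.extendedRees
    (Localization.AtPrime (𝔫.map (F.extendedReesMap F' fun n => (heq n).ge)))]
  rfl

variable {I' : ℕ → Ideal A'} (e : extReesAlgebra I' ≃+* F'.extendedRees)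
  (he : ∀ x, ((e x : F'.extendedRees) : A'[T;T⁻¹]) = x)

/-- **CHART → STALK → GAME SIDE.** Over `A' = M⁻¹A` with `𝒥ₙ' = 𝒥ₙ A' = Iₙ'`, for a prime `𝔫` of `⊕ 𝒥ₙ tⁿ` missing `M` and the
identification `e : extReesAlgebra I' ≅ ⊕ 𝒥ₙ' tⁿ`: the local ring `(⊕ 𝒥ₙ tⁿ)_𝔫` is the local ring of the GAME-SIDE carrier
`extReesAlgebra I'` at the prime `𝔫' = e⁻¹(𝔫 ⊕𝒥ₙ'tⁿ)`, by a ring isomorphism compatible with the structure maps. With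
`M = A ∖ 𝔭` and `𝒥ₙ` the pieces of a Rees filtration over an affine chart: the local rings of the global cobordant blow-up
`Spec_Y ⊕ 𝒥ₙ tⁿ` at the points over `y` are the `Localization.AtPrime 𝔫'` of `extReesAlgebra` of the STALK filtration — the
successors of the door crux's local weighted game. [cite: Wlodarczyk2022, Def. 5.1.1] -/
theorem exists_ringEquiv_localization_extReesAlgebra [(𝔫.map (F.extendedReesMap F' fun n => (heq n).ge)).IsPrime] :
    ∃ g : Localization.AtPrime 𝔫 ≃+*
        Localization.AtPrime ((𝔫.map (F.extendedReesMap F' fun n => (heq n).ge)).map e.symm),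
      ∀ x : F.extendedRees, g (algebraMap F.extendedRees (Localization.AtPrime 𝔫) x) =
        algebraMap (extReesAlgebra I') _ (e.symm (F.extendedReesMap F' (fun n => (heq n).ge) x)) := by
  obtain ⟨f, hf⟩ := F.exists_ringEquiv_localization_map_extendedReesMap F' M heq 𝔫 hd
  obtain ⟨f', hf'⟩ := exists_ringEquiv_localizationAtPrime_map e.symm
    (𝔫.map (F.extendedReesMap F' fun n => (heq n).ge))
  exact ⟨f.trans f', fun x => by rw [RingEquiv.trans_apply, hf, hf']⟩

include he

/-- DICTIONARY at the prime, exceptional fibre: `t⁻¹ ∈ 𝔫'` iff `t⁻¹ ∈ 𝔫`. [cite: Wlodarczyk2022, Lemma 2.3.8] -/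
theorem tInv_mem_iff_T_mem [(𝔫.map (F.extendedReesMap F' fun n => (heq n).ge)).IsPrime] :
    extReesAlgebra.tInv I' ∈ (𝔫.map (F.extendedReesMap F' fun n => (heq n).ge)).map e.symm ↔
      (⟨T (-1), F.T_neg_one_mem_extendedRees⟩ : F.extendedRees) ∈ 𝔫 := by
  rw [F.T_mem_iff_T_mem_map F' M heq 𝔫 hd, ← F'.ringEquiv_tInv e he,
    ← Ideal.symm_apply_mem_of_equiv_iff (f := e.symm), RingEquiv.symm_symm]

/-- DICTIONARY at the prime, vertex: `𝔫'` contains the vertex ideal iff `𝔫` contains the irrelevant ideal (so `𝔫'` is a point of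
`B₊` of the game side iff `𝔫` is a point of `B₊ = B ∖ V(R₊)` of the global cobordant blow-up). [cite: Wlodarczyk2022, Def. 5.1.1] -/
theorem vertexIdeal_le_iff_irrelevant_le (hI' : F'.ideal = I')
    [(𝔫.map (F.extendedReesMap F' fun n => (heq n).ge)).IsPrime] :
    extReesAlgebra.vertexIdeal I' ≤ (𝔫.map (F.extendedReesMap F' fun n => (heq n).ge)).map e.symm ↔
      F.irrelevant ≤ 𝔫 := by
  rw [F.irrelevant_le_iff_irrelevant_le_map F' M heq 𝔫 hd, F'.irrelevant_le_iff_vertexIdeal_le_comap e he hI',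
    Ideal.map_symm]

/-- DICTIONARY at the prime, base point: `𝔫'` lies over the extension of an ideal `𝔭 ≤ A` to `A'` iff `𝔫` lies over `𝔭`
(e.g. `𝔭` the prime of the point `y`, `A' = A_𝔭`, so that `𝔫'` lies over the maximal ideal of `𝒪_{Y,y}`). [cite: Wlodarczyk2022, Def. 5.1.1] -/
theorem map_algebraMap_le_iff_map_algebraMap_le (𝔭 : Ideal A)
    [(𝔫.map (F.extendedReesMap F' fun n => (heq n).ge)).IsPrime] :
    (𝔭.map (algebraMap A A')).map (algebraMap A' (extReesAlgebra I')) ≤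
        (𝔫.map (F.extendedReesMap F' fun n => (heq n).ge)).map e.symm ↔
      𝔭.map (algebraMap A F.extendedRees) ≤ 𝔫 := by
  have hle : ∀ n, (F.ideal n).map (algebraMap A A') ≤ F'.ideal n := fun n => (heq n).ge
  rw [Ideal.map_map, Ideal.map_le_iff_le_comap, Ideal.map_le_iff_le_comap]
  refine forall₂_congr fun a _ => ?_
  rw [Ideal.mem_comap, Ideal.mem_comap, F.mem_iff_extendedReesMap_mem_map F' M heq 𝔫 hd, extendedReesMap_algebraMap,
    RingHom.comp_apply, ← apply_algebraMap_eq e.symm (coe_symm_apply_eq e he) (algebraMap A A' a),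
    Ideal.apply_mem_of_equiv_iff (f := e.symm)]

end IdealFiltration

end StalkBridge

/-! ## §6 The FILTRATION-FREE packaging: from `(A, 𝒥)`, `A' = M⁻¹A` and `Iₙ' = 𝒥ₙ A'` straight to the game-side local ring

The consumer ([S6]) holds the chart filtration `F` on `A = Γ(Y, U)`, a localisation `A'` of `A` (the stalk `𝒪_{Y,y}` or the
localised model `Γ(Y,U)_𝔮`) and the IDEALS `Iₙ' = 𝒥ₙ A'` (`stalkIdeal`, or `weightedMonomialIdeal u w n` by the game clause),
but no `IdealFiltration A'`; the localised filtration is built inside the proof. -/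

section Packaging

variable {A : Type u} [CommRing A] {A' : Type v} [CommRing A'] [Algebra A A']
  (F : IdealFiltration A) (M : Submonoid A) [IsLocalization M A']
  {I' : ℕ → Ideal A'} (hI' : ∀ n, I' n = (F.ideal n).map (algebraMap A A'))
  (𝔫 : Ideal F.extendedRees) [𝔫.IsPrime]
  (hd : Disjoint ((M.map (algebraMap A F.extendedRees) : Submonoid F.extendedRees) : Set F.extendedRees) 𝔫)

include M hI' hd

/-- **CHART → GAME SIDE at a prime, filtration-free form.** For the chart filtration `𝒥` on `A`, a localisation `A' = M⁻¹A`,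
ideals `Iₙ' = 𝒥ₙ A'` of `A'`, and a prime `𝔫` of `⊕ 𝒥ₙ tⁿ` missing `M`: there are a prime `𝔫'` of the game-side carrier
`extReesAlgebra I'` and a ring isomorphism `g : (⊕ 𝒥ₙ tⁿ)_𝔫 ≃+* (extReesAlgebra I')_{𝔫'}` such that (i) the structure maps from
`A` match (`A → ⊕𝒥ₙtⁿ → (⊕𝒥ₙtⁿ)_𝔫 ≅ …` = `A → A' → extReesAlgebra I' → (extReesAlgebra I')_{𝔫'}`), (ii) `t⁻¹ ∈ 𝔫' ↔ t⁻¹ ∈ 𝔫`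
(exceptional fibre), (iii) `vertexIdeal ≤ 𝔫' ↔ irrelevant ≤ 𝔫` (vertex, i.e. `B ∖ B₊`), (iv) for every `𝔭 ≤ A`:
`(𝔭A') · extReesAlgebra I' ≤ 𝔫' ↔ 𝔭 · ⊕𝒥ₙtⁿ ≤ 𝔫` (base point). With `A = Γ(Y,U)`, `M = A ∖ 𝔭_y`, `A' = 𝒪_{Y,y}` (or
`Γ(Y,U)_{𝔭_y}`), `Iₙ' = J(𝒪_{Y,y}, f_y)ₙ = weightedMonomialIdeal u w n`: the local ring of the global cobordant blow-up at a
point over `y` IS a successor `Localization.AtPrime 𝔫'` of the door crux's local game, with matching exceptional-fibre / vertex /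
base-point conditions. [cite: Wlodarczyk2022, Def. 5.1.1] -/
theorem IdealFiltration.exists_prime_extReesAlgebra_ringEquiv_localization :
    ∃ (𝔫' : Ideal (extReesAlgebra I')) (_ : 𝔫'.IsPrime)
      (g : Localization.AtPrime 𝔫 ≃+* Localization.AtPrime 𝔫'),
      (∀ a : A, g (algebraMap F.extendedRees (Localization.AtPrime 𝔫) (algebraMap A F.extendedRees a)) =
          algebraMap (extReesAlgebra I') _ (algebraMap A' (extReesAlgebra I') (algebraMap A A' a))) ∧
      (extReesAlgebra.tInv I' ∈ 𝔫' ↔ (⟨T (-1), F.T_neg_one_mem_extendedRees⟩ : F.extendedRees) ∈ 𝔫) ∧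
      (extReesAlgebra.vertexIdeal I' ≤ 𝔫' ↔ F.irrelevant ≤ 𝔫) ∧
      (∀ 𝔭 : Ideal A, (𝔭.map (algebraMap A A')).map (algebraMap A' (extReesAlgebra I')) ≤ 𝔫' ↔
          𝔭.map (algebraMap A F.extendedRees) ≤ 𝔫) := by
  -- the localised filtration, built in place
  let F' : IdealFiltration A' :=
    { ideal := I'
      ideal_zero := by rw [hI' 0, F.ideal_zero, Ideal.map_top]
      antitone := fun m n h => by rw [hI' m, hI' n]; exact Ideal.map_mono (F.antitone h)
      mul_le := fun m n => by
        rw [hI' m, hI' n, hI' (m + n), ← Ideal.map_mul]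
        exact Ideal.map_mono (F.mul_le m n) }
  have heq : ∀ n, F'.ideal n = (F.ideal n).map (algebraMap A A') := hI'
  have hF'I : F'.ideal = I' := rfl
  obtain ⟨e, he⟩ := F'.exists_ringEquiv_extReesAlgebra hF'I
  haveI := F.isPrime_map_extendedReesMap F' M heq 𝔫 hd
  obtain ⟨g, hg⟩ := F.exists_ringEquiv_localization_extReesAlgebra F' M heq 𝔫 hd e
  refine ⟨_, inferInstance, g, fun a => F.ringEquiv_localization_algebraMap_base F' (fun n => (heq n).ge) e he 𝔫 _ g hg a,
    F.tInv_mem_iff_T_mem F' M heq 𝔫 hd e he, F.vertexIdeal_le_iff_irrelevant_le F' M heq 𝔫 hd e he hF'I,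
    fun 𝔭 => F.map_algebraMap_le_iff_map_algebraMap_le F' M heq 𝔫 hd e he 𝔭⟩

end Packaging

end Literature.AlgebraicGeometry.Resolution

end
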